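import Summits.QuantumFields.YangMills.Theorems.BalabanUVNodesN07AliasSumMarginCore
import HarnessLib

/-!
# DAG node N07 (road R0′ at the record; the `hker` ∕ `hpos` letter) — THE SHARP ONE-LEVEL MARGIN, part 1 (abstract core):
# convexity from `iterMono 2`, the alternating lemma, the abstract «centre − matched ≥ 0», and «domination constants multiply» at any order

Width seat `pub-ymgap-dag-n07-w7` (g5), `--supports stmt-QuantumFields-27364 --as helper`; count-neutral; 0 `def`.
Sequel of this lineage's `…N07AliasSumMarginCore` ∕ `…N07AliasSumMargin` (g4: the one-level margin `K₀(θ) ≤ π^{|J|}·K(θ)`) and of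
dag-n07-w5 g2's `…N07AliasSumMarginSharpSmallL` (the SHARP constant `1` at block side `L = 3`).  Part 2 (`…N07AliasSumMarginSharp`)
proves the sharp constant ONE for EVERY odd block side `L ≥ 3`; THIS FILE is its vocabulary-free core.

WHAT.  §1 `iterMono 2` functions (positive, non-increasing, with non-increasing differences on `(0,∞)`) are CONVEX on `(0,∞)`:
★ `secant_of_iterMono_two` (three-point convexity by chaining equal steps and an `n → ∞` squeeze — no measurability folklore) and
`convexOn_of_iterMono_two` (Mathlib's `ConvexOn`, via `convexOn_iff_slope_mono_adjacent`).  §2 `altSum_nonneg_of_antitone`: an alternating sum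
`Σ_{d=1}^{c} (−1)^{d+1} t_d` of a non-increasing non-negative sequence is `≥ 0`; `sum_range_two_mul_of_symm` folds a
reflection-symmetric sum `Σ_{m<2c}` onto `2·Σ_{m<c}`.  §3 ★★ `centreMinusMatched_nonneg` — the ABSTRACT form of the
sharp inequality: for points `y_j > 0`, nodes `0 < Y_1 < … < Y_c` off the points with VANISHING alias sums `Σ_j (Y_d − y_j)⁻¹ = 0`, weights
`κ_1 ≥ … ≥ κ_c ≥ 0` and `G ∈ iterMono 2`: `0 ≤ Σ_{d=1}^{c} (−1)^{d+1} κ_d Σ_j G(y_j)∕(Y_d − y_j)` (each `Σ_j G(y_j)∕(Y_d − y_j) =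
Σ_j [G(y_j) − G(Y_d)]∕(Y_d − y_j)` is a sum of NEGATED SECANT SLOPES of `G` from the node `Y_d`: non-negative because `G` is non-increasing,
non-increasing in `d` because the slopes of a convex function increase with the far point — then §2).  §4 ★★ `aliasCore_margin_fin_of_order` ∕
`aliasCore_margin_of_order`: g4's «one-coordinate domination constants MULTIPLY» with the one-coordinate hypothesis asked only for
`G ∈ iterMono k₀` (any `k₀`; `k₀ = 1` is `aliasCore_margin`) — the same induction, `aliasCore_iterMono` at order `k₀`.

HONEST SCOPE.  Elementary real analysis on finite sums ([folklore] throughout); nothing of [B11]∕[B6]∕[3] is asserted; road items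
(L2) (discrete Caccioppoli), (L4) (assembly) and the multi-level `(P)_D` stay OPEN; `hker`, stub 1, K0⁷∕K1⁹ NOT closed; N07 not
discharged; nothing continuum ∕ OS ∕ mass gap ∕ Clay.  Context: T. Bałaban, CMP **96** (1984) 223–250 [Balaban1984PropagatorsII] (2.22)
p.226 — nothing is cited as a hypothesis.
-/

set_option autoImplicit false

noncomputable section

open Finset

namespace Summit.QuantumFields.YangMills.Theorems.N07AliasSumMarginSharp

open Summit.QuantumFields.YangMills.Theorems.N07AliasSumPositivity
open Summit.QuantumFields.YangMills.Theorems.N07AliasSumMargin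

/-! ## §1  `iterMono 2` functions are convex on `(0,∞)` -/

/-- Chaining equal steps: for `F ∈ iterMono 2`, `0 < a`, `δ > 0`, `n ≥ 1` steps from `a` to `b = a + nδ`, and any point `z ≥ b − δ`
(`z > 0`), the difference `F z − F (z + δ)` is at most the AVERAGE step `(F a − F b) ∕ n` (every step `F(a+iδ) − F(a+(i+1)δ)`, `i < n`,
dominates it, the differences being non-increasing). [folklore] -/
theorem sub_le_avg_step_of_iterMono_two {F : ℝ → ℝ} (hF : F ∈ iterMono 2) {a δ : ℝ} (ha : 0 < a) (hδ : 0 < δ)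
    {n : ℕ} (hn : 1 ≤ n) {z : ℝ} (hz : a + (n - 1 : ℕ) * δ ≤ z) :
    (n : ℝ) * (F z - F (z + δ)) ≤ F a - F (a + n * δ) := by
  -- the difference function is `iterMono 1`, hence non-increasing on `(0,∞)`
  have hD : (fun x => F x - F (x + δ)) ∈ iterMono 1 := hF.2 δ hδ
  have hstep : ∀ i ∈ range n, F z - F (z + δ) ≤ F (a + i * δ) - F (a + (i + 1 : ℕ) * δ) := by
    intro i hi
    rw [mem_range] at hi
    have hpos : 0 < a + i * δ := by positivity
    have hle : a + i * δ ≤ z := by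
      have hi' : (i : ℝ) ≤ ((n - 1 : ℕ) : ℝ) := by exact_mod_cast (by omega : i ≤ n - 1)
      nlinarith
    have h := iterMono_antitone (k := 0) hD hpos hle
    have e : a + i * δ + δ = a + ((i + 1 : ℕ) : ℝ) * δ := by push_cast; ring
    rw [e] at h
    exact h
  have hsum : ∑ i ∈ range n, (F (a + i * δ) - F (a + (i + 1 : ℕ) * δ)) = F a - F (a + n * δ) := by
    rw [Finset.sum_range_sub' (fun i => F (a + (i : ℕ) * δ)) n]
    simp
  calc (n : ℝ) * (F z - F (z + δ)) = ∑ i ∈ range n, (F z - F (z + δ)) := by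
        rw [sum_const, card_range, nsmul_eq_mul]
    _ ≤ ∑ i ∈ range n, (F (a + i * δ) - F (a + (i + 1 : ℕ) * δ)) := sum_le_sum hstep
    _ = F a - F (a + n * δ) := hsum

/-- ★ **Three-point convexity of `iterMono 2` functions.**  For `F ∈ iterMono 2` (positive, non-increasing, non-increasing differences on
`(0,∞)`) and `0 < a < b < c`: `(F b − F c)·(b − a) ≤ (F a − F b)·(c − b)` — the secant slopes increase.  Proof: with `δ = (b − a)∕n`
and `q = ⌊(c − b)∕δ⌋`, `F b − F c ≤ F b − F(b + (q+1)δ) = Σ_{i ≤ q} [F(b+iδ) − F(b+(i+1)δ)] ≤ (q+1)(F a − F b)∕n` by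
`sub_le_avg_step_of_iterMono_two`, and `(q+1)δ ≤ (c − b) + (b − a)∕n`; let `n → ∞`. [folklore] -/
theorem secant_of_iterMono_two {F : ℝ → ℝ} (hF : F ∈ iterMono 2) {a b c : ℝ} (ha : 0 < a) (hab : a < b) (hbc : b < c) :
    (F b - F c) * (b - a) ≤ (F a - F b) * (c - b) := by
  have hFab : 0 ≤ F a - F b := by
    have := iterMono_antitone (k := 1) hF ha hab.le; linarith
  refine le_of_forall_pos_le_add (fun ε hε => ?_)
  -- choose `n` with `(F a − F b)(b − a) < n ε`
  obtain ⟨n, hn⟩ := exists_nat_gt ((F a - F b) * (b - a) / ε)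
  have hn1 : 1 ≤ n := by
    by_contra h
    have h0 : n = 0 := by omega
    rw [h0, Nat.cast_zero] at hn
    have : 0 ≤ (F a - F b) * (b - a) / ε := div_nonneg (mul_nonneg hFab (by linarith)) hε.le
    linarith
  have hnpos : (0 : ℝ) < n := by exact_mod_cast (show 0 < n by omega)
  set δ : ℝ := (b - a) / n with hδdef
  have hδ : 0 < δ := div_pos (by linarith) hnpos
  have hnδ : (n : ℝ) * δ = b - a := by rw [hδdef]; field_simp
  -- `q = ⌊(c − b)∕δ⌋`
  set q : ℕ := ⌊(c - b) / δ⌋₊ with hqdef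
  have hq1 : (q : ℝ) * δ ≤ c - b := by
    have h := Nat.floor_le (div_nonneg (by linarith : 0 ≤ c - b) hδ.le)
    rw [← hqdef] at h
    exact (le_div_iff₀ hδ).mp h
  have hq2 : c - b < ((q + 1 : ℕ) : ℝ) * δ := by
    have h := Nat.lt_floor_add_one ((c - b) / δ)
    rw [← hqdef] at h
    have h' : (c - b) / δ < ((q + 1 : ℕ) : ℝ) := by push_cast; exact h
    exact (div_lt_iff₀ hδ).mp h'
  -- each step from `b` on is at most the average step on `[a,b]`
  have hsteps : ∀ i ∈ range (q + 1), F (b + i * δ) - F (b + (i + 1 : ℕ) * δ) ≤ (F a - F b) / n := by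
    intro i _
    have hz : a + ((n - 1 : ℕ) : ℝ) * δ ≤ b + i * δ := by
      have h1 : ((n - 1 : ℕ) : ℝ) * δ ≤ n * δ := by
        have : ((n - 1 : ℕ) : ℝ) ≤ n := by exact_mod_cast Nat.sub_le n 1
        nlinarith
      have h2 : (0 : ℝ) ≤ i * δ := by positivity
      linarith
    have h := sub_le_avg_step_of_iterMono_two hF ha hδ hn1 hz
    rw [hnδ, show a + (b - a) = b by ring] at h
    have e : b + i * δ + δ = b + ((i + 1 : ℕ) : ℝ) * δ := by push_cast; ring
    rw [e] at h
    rw [le_div_iff₀ hnpos]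
    linarith
  have htel : ∑ i ∈ range (q + 1), (F (b + i * δ) - F (b + (i + 1 : ℕ) * δ)) = F b - F (b + (q + 1 : ℕ) * δ) := by
    rw [Finset.sum_range_sub' (fun i => F (b + (i : ℕ) * δ)) (q + 1)]
    simp
  have hchain : F b - F (b + (q + 1 : ℕ) * δ) ≤ ((q + 1 : ℕ) : ℝ) * ((F a - F b) / n) := by
    rw [← htel]
    calc ∑ i ∈ range (q + 1), (F (b + i * δ) - F (b + (i + 1 : ℕ) * δ))
        ≤ ∑ i ∈ range (q + 1), (F a - F b) / n := sum_le_sum hsteps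
      _ = ((q + 1 : ℕ) : ℝ) * ((F a - F b) / n) := by rw [sum_const, card_range, nsmul_eq_mul]
  -- `F c ≥ F (b + (q+1)δ)` since `c ≤ b + (q+1)δ`
  have hcF : F (b + (q + 1 : ℕ) * δ) ≤ F c :=
    iterMono_antitone (k := 1) hF (by linarith) (by linarith)
  -- assemble
  have hmain : (F b - F c) * (b - a) ≤ (F a - F b) * ((c - b) + δ) := by
    have h1 : F b - F c ≤ ((q + 1 : ℕ) : ℝ) * ((F a - F b) / n) := by linarith
    have h2 : ((q + 1 : ℕ) : ℝ) * δ ≤ (c - b) + δ := by push_cast; linarith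
    have h3 : ((q + 1 : ℕ) : ℝ) * ((F a - F b) / n) * (b - a) = (F a - F b) * (((q + 1 : ℕ) : ℝ) * δ) := by
      rw [hδdef]; field_simp
    calc (F b - F c) * (b - a) ≤ ((q + 1 : ℕ) : ℝ) * ((F a - F b) / n) * (b - a) :=
          mul_le_mul_of_nonneg_right h1 (by linarith)
      _ = (F a - F b) * (((q + 1 : ℕ) : ℝ) * δ) := h3
      _ ≤ (F a - F b) * ((c - b) + δ) := mul_le_mul_of_nonneg_left h2 hFab
  have hεb : (F a - F b) * δ ≤ ε := by
    rw [hδdef, mul_div_assoc']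
    rw [div_le_iff₀ hnpos]
    have := (div_lt_iff₀ hε).mp hn
    linarith
  calc (F b - F c) * (b - a) ≤ (F a - F b) * ((c - b) + δ) := hmain
    _ = (F a - F b) * (c - b) + (F a - F b) * δ := by ring
    _ ≤ (F a - F b) * (c - b) + ε := by linarith

/-- `iterMono 2` functions are CONVEX on `(0,∞)` in Mathlib's sense (`convexOn_iff_slope_mono_adjacent` and
`secant_of_iterMono_two`). [folklore] -/
theorem convexOn_of_iterMono_two {F : ℝ → ℝ} (hF : F ∈ iterMono 2) : ConvexOn ℝ (Set.Ioi (0 : ℝ)) F := by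
  refine convexOn_iff_slope_mono_adjacent.mpr ⟨convex_Ioi 0, ?_⟩
  intro x y z hx _ hxy hyz
  have h := secant_of_iterMono_two hF hx hxy hyz
  rw [div_le_div_iff₀ (by linarith) (by linarith)]
  have e1 : (F y - F x) * (z - y) = -((F x - F y) * (z - y)) := by ring
  have e2 : (F z - F y) * (y - x) = -((F y - F z) * (y - x)) := by ring
  rw [e1, e2]
  linarith

/-- NEGATED SECANT SLOPES of an `iterMono 2` function from a node are non-negative: for `0 < p`, `0 < u`, `u ≠ p`,
`0 ≤ (G p − G u) ∕ (u − p)` (`G` non-increasing). [folklore] -/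
theorem negSlope_nonneg_of_iterMono_two {G : ℝ → ℝ} (hG : G ∈ iterMono 2) {p u : ℝ} (hp : 0 < p) (hu : 0 < u)
    (hup : u ≠ p) : 0 ≤ (G p - G u) / (u - p) := by
  rcases lt_or_gt_of_ne hup with h | h
  · have hle : G p ≤ G u := iterMono_antitone (k := 1) hG hu h.le
    exact div_nonneg_of_nonpos (by linarith) (by linarith)
  · have hle : G u ≤ G p := iterMono_antitone (k := 1) hG hp h.le
    exact div_nonneg (by linarith) (by linarith)

/-- NEGATED SECANT SLOPES of an `iterMono 2` function DECREASE as the far point moves right: for `0 < p`, `0 < u ≤ v`, both `≠ p`,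
`(G p − G v) ∕ (v − p) ≤ (G p − G u) ∕ (u − p)` (`ConvexOn.secant_mono`). [folklore] -/
theorem negSlope_antitone_of_iterMono_two {G : ℝ → ℝ} (hG : G ∈ iterMono 2) {p u v : ℝ} (hp : 0 < p) (hu : 0 < u)
    (hv : 0 < v) (hup : u ≠ p) (hvp : v ≠ p) (huv : u ≤ v) :
    (G p - G v) / (v - p) ≤ (G p - G u) / (u - p) := by
  have h := (convexOn_of_iterMono_two hG).secant_mono (a := p) (x := u) (y := v) hp hu hv hup hvp huv
  have e1 : (G p - G v) / (v - p) = -((G v - G p) / (v - p)) := by ring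
  have e2 : (G p - G u) / (u - p) = -((G u - G p) / (u - p)) := by ring
  rw [e1, e2]
  linarith

/-! ## §2  Alternating sums of non-increasing non-negative sequences -/

/-- An alternating sum `Σ_{d<c} (−1)^d t (d+1) = t 1 − t 2 + t 3 − …` of a sequence that is NON-INCREASING and NON-NEGATIVE on
`1, …, c` is non-negative (pair consecutive terms; an unpaired last term is `≥ 0`). [folklore] -/
theorem altSum_nonneg_of_antitone : ∀ (c : ℕ) (t : ℕ → ℝ),
    (∀ d d', 1 ≤ d → d ≤ d' → d' ≤ c → t d' ≤ t d) → (∀ d, 1 ≤ d → d ≤ c → 0 ≤ t d) →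
    0 ≤ ∑ d ∈ range c, (-1 : ℝ) ^ d * t (d + 1)
  | 0, t, _, _ => by simp
  | 1, t, _, hnn => by simpa using hnn 1 le_rfl le_rfl
  | c + 2, t, hmono, hnn => by
    rw [sum_range_succ', sum_range_succ']
    have ih := altSum_nonneg_of_antitone c (fun e => t (e + 2))
      (fun d d' h1 h2 h3 => hmono _ _ (by omega) (by omega) (by omega))
      (fun d h1 h2 => hnn _ (by omega) (by omega))
    have h12 : t 2 ≤ t 1 := hmono 1 2 le_rfl (by norm_num) (by omega)
    have e : ∀ d : ℕ, (-1 : ℝ) ^ (d + 1 + 1) * t (d + 1 + 1 + 1) = (-1 : ℝ) ^ d * t (d + 2 + 1) := by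
      intro d; rw [pow_succ, pow_succ]; ring_nf
    simp only [e, pow_zero, one_mul, zero_add, pow_one] at ih ⊢
    linarith

/-- Folding a sum with a reflection symmetry: if `φ (2c−1−m) = φ m` for `m < 2c` then `Σ_{m<2c} φ m = 2 Σ_{m<c} φ m`. [folklore] -/
theorem sum_range_two_mul_of_symm (c : ℕ) (φ : ℕ → ℝ) (hφ : ∀ m, m < 2 * c → φ (2 * c - 1 - m) = φ m) :
    ∑ m ∈ range (2 * c), φ m = 2 * ∑ m ∈ range c, φ m := by
  rw [two_mul c, sum_range_add, two_mul]
  congr 1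
  rw [← sum_range_reflect (fun m => φ (c + m)) c]
  refine sum_congr rfl (fun m hm => ?_)
  rw [mem_range] at hm
  have e : c + (c - 1 - m) = 2 * c - 1 - m := by omega
  simp only [e]
  exact hφ m (by omega)

/-! ## §3  The abstract «centre − matched ≥ 0» -/

/-- The node sums as sums of negated secant slopes: if `Σ_j (Y − y_j)⁻¹ = 0` then
`Σ_j G(y_j) ∕ (Y − y_j) = Σ_j (G(y_j) − G(Y)) ∕ (Y − y_j)`. [folklore] -/
theorem nodeSum_eq_sum_negSlope {L : ℕ} (y : ℕ → ℝ) (Y : ℝ) (G : ℝ → ℝ)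
    (hvanish : ∑ j ∈ range L, (Y - y j)⁻¹ = 0) :
    ∑ j ∈ range L, G (y j) / (Y - y j) = ∑ j ∈ range L, (G (y j) - G Y) / (Y - y j) := by
  have h : ∑ j ∈ range L, G Y / (Y - y j) = 0 := by
    have e : ∑ j ∈ range L, G Y / (Y - y j) = G Y * ∑ j ∈ range L, (Y - y j)⁻¹ := by
      rw [mul_sum]; exact sum_congr rfl (fun j _ => by rw [div_eq_mul_inv])
    rw [e, hvanish, mul_zero]
  have e2 : ∑ j ∈ range L, (G (y j) - G Y) / (Y - y j)
      = ∑ j ∈ range L, G (y j) / (Y - y j) - ∑ j ∈ range L, G Y / (Y - y j) := by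
    rw [← sum_sub_distrib]; exact sum_congr rfl (fun j _ => by rw [sub_div])
  rw [e2, h, sub_zero]

/-- ★★ **Centre minus matched is non-negative (abstract form).**  Let `y_0, …, y_{L−1} > 0` be points, `Y_1, …, Y_c > 0` NODES,
non-decreasing in `d`, none equal to a point, with VANISHING ALIAS SUMS `Σ_j (Y_d − y_j)⁻¹ = 0` (`1 ≤ d ≤ c`), `κ_1 ≥ … ≥ κ_c ≥ 0`
weights, and `G ∈ iterMono 2`.  Then `0 ≤ Σ_{d<c} (−1)^d κ_{d+1} Σ_j G(y_j)∕(Y_{d+1} − y_j)` (`= κ_1Ψ_1 − κ_2Ψ_2 + …`): by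
`nodeSum_eq_sum_negSlope` each `Ψ_d` is a sum of negated secant slopes of `G` from `Y_d`, non-negative (`negSlope_nonneg_of_iterMono_two`)
and non-increasing in `d` (`negSlope_antitone_of_iterMono_two`), and `altSum_nonneg_of_antitone` concludes. [folklore] -/
theorem centreMinusMatched_nonneg {L c : ℕ} (y Y κ : ℕ → ℝ)
    (hy : ∀ j, j < L → 0 < y j)
    (hY0 : ∀ d, 1 ≤ d → d ≤ c → 0 < Y d)
    (hYmono : ∀ d d', 1 ≤ d → d ≤ d' → d' ≤ c → Y d ≤ Y d')
    (hne : ∀ d j, 1 ≤ d → d ≤ c → j < L → Y d ≠ y j)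
    (hκ0 : ∀ d, 1 ≤ d → d ≤ c → 0 ≤ κ d)
    (hκmono : ∀ d d', 1 ≤ d → d ≤ d' → d' ≤ c → κ d' ≤ κ d)
    (hvanish : ∀ d, 1 ≤ d → d ≤ c → ∑ j ∈ range L, (Y d - y j)⁻¹ = 0)
    {G : ℝ → ℝ} (hG : G ∈ iterMono 2) :
    0 ≤ ∑ d ∈ range c, (-1 : ℝ) ^ d * (κ (d + 1) * ∑ j ∈ range L, G (y j) / (Y (d + 1) - y j)) := by
  -- the node sums as sums of negated slopes
  set Ψ : ℕ → ℝ := fun d => ∑ j ∈ range L, (G (y j) - G (Y d)) / (Y d - y j) with hΨ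
  have hΨeq : ∀ d, 1 ≤ d → d ≤ c → ∑ j ∈ range L, G (y j) / (Y d - y j) = Ψ d :=
    fun d h1 h2 => nodeSum_eq_sum_negSlope y (Y d) G (hvanish d h1 h2)
  have hΨ0 : ∀ d, 1 ≤ d → d ≤ c → 0 ≤ Ψ d := by
    intro d h1 h2
    refine sum_nonneg (fun j hj => ?_)
    rw [mem_range] at hj
    exact negSlope_nonneg_of_iterMono_two hG (hy j hj) (hY0 d h1 h2) (hne d j h1 h2 hj)
  have hΨmono : ∀ d d', 1 ≤ d → d ≤ d' → d' ≤ c → Ψ d' ≤ Ψ d := by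
    intro d d' h1 h2 h3
    refine sum_le_sum (fun j hj => ?_)
    rw [mem_range] at hj
    exact negSlope_antitone_of_iterMono_two hG (hy j hj) (hY0 d h1 (by omega)) (hY0 d' (by omega) h3)
      (hne d j h1 (by omega) hj) (hne d' j (by omega) h3 hj) (hYmono d d' h1 h2 h3)
  have e : ∑ d ∈ range c, (-1 : ℝ) ^ d * (κ (d + 1) * ∑ j ∈ range L, G (y j) / (Y (d + 1) - y j))
      = ∑ d ∈ range c, (-1 : ℝ) ^ d * (κ (d + 1) * Ψ (d + 1)) := by
    refine sum_congr rfl (fun d hd => ?_)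
    rw [mem_range] at hd
    rw [hΨeq (d + 1) (by omega) (by omega)]
  rw [e]
  refine altSum_nonneg_of_antitone c (fun d => κ d * Ψ d) ?_ ?_
  · intro d d' h1 h2 h3
    exact mul_le_mul (hκmono d d' h1 h2 h3) (hΨmono d d' h1 h2 h3) (hΨ0 d' (by omega) h3) (hκ0 d h1 (by omega))
  · intro d h1 h2
    exact mul_nonneg (hκ0 d h1 h2) (hΨ0 d h1 h2)

/-! ## §4  Domination constants multiply — at any order `k₀` -/

/-- ★★ **Domination constants multiply, one-coordinate hypothesis at order `k₀` (`Fin n` form).**  As `aliasCore_margin_fin`, but the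
one-coordinate domination `w κ · Σ_{m<L} G(x + (s κ m)²)∕(s κ m)² ≤ transfer L (s κ) G x` is asked only for `G ∈ iterMono k₀`
(`k₀ = 1`: positive non-increasing; `k₀ = 2`: moreover convex — the class of the SHARP constant); the inner alternating sums are
`iterMono k₀` by `aliasCore_iterMono` at order `k₀`, so the same induction runs. [folklore] -/
theorem aliasCore_margin_fin_of_order {L : ℕ} (hL : Odd L) (k₀ : ℕ) : ∀ (n : ℕ) (s : Fin n → ℕ → ℝ),
    (∀ κ m, m < L → 0 < s κ m) →
    (∀ κ, ∃ p, ((∀ m m', m ≤ m' → m' ≤ p → m' < L → s κ m ≤ s κ m') ∧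
      (∀ m m', p + 1 ≤ m → m ≤ m' → m' < L → s κ m' ≤ s κ m))) →
    ∀ (w : Fin n → ℝ), (∀ κ, 0 ≤ w κ) →
    (∀ κ (G : ℝ → ℝ), G ∈ iterMono k₀ → ∀ x : ℝ, 0 ≤ x →
      w κ * ∑ m ∈ range L, G (x + s κ m ^ 2) / s κ m ^ 2 ≤ transfer L (s κ) G x) →
    ∀ (F : ℝ → ℝ), (∀ k, F ∈ iterMono k) → ∀ (x : ℝ), 0 ≤ x →
    (∏ κ, w κ) * ∑ m : Fin n → Fin L, (∏ κ, (s κ (m κ) ^ 2)⁻¹) * F (x + ∑ κ, s κ (m κ) ^ 2)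
      ≤ ∑ m : Fin n → Fin L, (∏ κ, (-1 : ℝ) ^ (m κ : ℕ) / s κ (m κ)) * F (x + ∑ κ, s κ (m κ) ^ 2) := by
  intro n
  induction n with
  | zero =>
    intro s _ _ w _ _ F _ x _
    simp only [Finset.univ_eq_empty, Finset.prod_empty, one_mul, le_refl]
  | succ n ih =>
    intro s hs0 hs w hw0 hw F hF x hx
    -- the inner alternating sum over the coordinates `1, …, n`, of order `k₀`
    set G : ℝ → ℝ := fun y => ∑ m' : Fin n → Fin L,
        (∏ κ, (-1 : ℝ) ^ (m' κ : ℕ) / s κ.succ (m' κ)) * F (y + ∑ κ, s κ.succ (m' κ) ^ 2) with hG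
    have hGm : G ∈ iterMono k₀ :=
      aliasCore_iterMono hL n (fun κ => s κ.succ) (fun κ m hm => hs0 κ.succ m hm) (fun κ => hs κ.succ) k₀ F (hF _)
    -- induction hypothesis at the shifted points
    have hIH : ∀ m₀ ∈ range L, (∏ κ : Fin n, w κ.succ) *
        ∑ m' : Fin n → Fin L, (∏ κ, (s κ.succ (m' κ) ^ 2)⁻¹) * F ((x + s 0 m₀ ^ 2) + ∑ κ, s κ.succ (m' κ) ^ 2)
          ≤ G (x + s 0 m₀ ^ 2) := by
      intro m₀ _
      exact ih (fun κ => s κ.succ) (fun κ m hm => hs0 κ.succ m hm) (fun κ => hs κ.succ) (fun κ => w κ.succ)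
        (fun κ => hw0 κ.succ) (fun κ => hw κ.succ) F hF (x + s 0 m₀ ^ 2) (add_nonneg hx (sq_nonneg _))
    -- the constant of coordinate `0`
    have hT : w 0 * ∑ m₀ ∈ range L, G (x + s 0 m₀ ^ 2) / s 0 m₀ ^ 2 ≤ transfer L (s 0) G x := hw 0 G hGm x hx
    have hRHS : ∑ m : Fin (n + 1) → Fin L, (∏ κ, (-1 : ℝ) ^ (m κ : ℕ) / s κ (m κ)) * F (x + ∑ κ, s κ (m κ) ^ 2)
        = transfer L (s 0) G x := aliasSum_fin_succ_eq_transfer n L s F x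
    rw [hRHS, matchedSum_fin_succ n L s F x, Fin.prod_univ_succ]
    have hws : ∀ m₀ ∈ range L, 0 ≤ (s 0 m₀ ^ 2)⁻¹ := fun m₀ _ => by positivity
    calc w 0 * (∏ κ : Fin n, w κ.succ) *
          ∑ m₀ ∈ range L, (s 0 m₀ ^ 2)⁻¹ * ∑ m' : Fin n → Fin L,
            (∏ κ, (s κ.succ (m' κ) ^ 2)⁻¹) * F ((x + s 0 m₀ ^ 2) + ∑ κ, s κ.succ (m' κ) ^ 2)
        = w 0 * ∑ m₀ ∈ range L, (s 0 m₀ ^ 2)⁻¹ * ((∏ κ : Fin n, w κ.succ) *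
            ∑ m' : Fin n → Fin L,
              (∏ κ, (s κ.succ (m' κ) ^ 2)⁻¹) * F ((x + s 0 m₀ ^ 2) + ∑ κ, s κ.succ (m' κ) ^ 2)) := by
          rw [mul_assoc, mul_sum]
          refine congrArg _ (sum_congr rfl (fun m₀ _ => ?_))
          ring
      _ ≤ w 0 * ∑ m₀ ∈ range L, (s 0 m₀ ^ 2)⁻¹ * G (x + s 0 m₀ ^ 2) := by
          refine mul_le_mul_of_nonneg_left (sum_le_sum (fun m₀ hm₀ => ?_)) (hw0 0)
          exact mul_le_mul_of_nonneg_left (hIH m₀ hm₀) (hws m₀ hm₀)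
      _ = w 0 * ∑ m₀ ∈ range L, G (x + s 0 m₀ ^ 2) / s 0 m₀ ^ 2 := by
          refine congrArg _ (sum_congr rfl (fun m₀ _ => ?_))
          rw [div_eq_inv_mul]
      _ ≤ transfer L (s 0) G x := hT

/-- ★★ **Domination constants multiply, one-coordinate hypothesis at order `k₀` (any finite index type).**  For odd `L`, positive
hill-shaped families `s κ` (`κ : J`), non-negative constants `w κ` dominating at order `k₀`
(`w κ · Σ_{m<L} G(x + (s κ m)²)∕(s κ m)² ≤ transfer L (s κ) G x` for every `G ∈ iterMono k₀`, `x ≥ 0`), `F` `k`-monotone for every `k`,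
and `x ≥ 0`:
`(Π_κ w κ) · Σ_{m : J → Fin L} (Π_κ (s κ (m κ))⁻²) F(x + Σ_κ (s κ (m κ))²) ≤ Σ_m (Π_κ (−1)^{m κ} ∕ s κ (m κ)) F(x + Σ_κ (s κ (m κ))²)`
— transport to `J = Fin n` exactly as in `aliasCore_margin`. [folklore] -/
theorem aliasCore_margin_of_order {J : Type*} [Fintype J] [DecidableEq J] {L : ℕ} (hL : Odd L) (k₀ : ℕ)
    (s : J → ℕ → ℝ) (hs0 : ∀ κ m, m < L → 0 < s κ m)
    (hs : ∀ κ, ∃ p, ((∀ m m', m ≤ m' → m' ≤ p → m' < L → s κ m ≤ s κ m') ∧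
      (∀ m m', p + 1 ≤ m → m ≤ m' → m' < L → s κ m' ≤ s κ m)))
    (w : J → ℝ) (hw0 : ∀ κ, 0 ≤ w κ)
    (hw : ∀ κ (G : ℝ → ℝ), G ∈ iterMono k₀ → ∀ x : ℝ, 0 ≤ x →
      w κ * ∑ m ∈ range L, G (x + s κ m ^ 2) / s κ m ^ 2 ≤ transfer L (s κ) G x)
    (F : ℝ → ℝ) (hF : ∀ k, F ∈ iterMono k) (x : ℝ) (hx : 0 ≤ x) :
    (∏ κ, w κ) * ∑ m : J → Fin L, (∏ κ, (s κ (m κ) ^ 2)⁻¹) * F (x + ∑ κ, s κ (m κ) ^ 2)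
      ≤ ∑ m : J → Fin L, (∏ κ, (-1 : ℝ) ^ (m κ : ℕ) / s κ (m κ)) * F (x + ∑ κ, s κ (m κ) ^ 2) := by
  set n := Fintype.card J with hn
  let eq : J ≃ Fin n := Fintype.equivFinOfCardEq rfl
  have key1 : ∑ m : J → Fin L, (∏ κ, (-1 : ℝ) ^ (m κ : ℕ) / s κ (m κ)) * F (x + ∑ κ, s κ (m κ) ^ 2) =
      ∑ m : Fin n → Fin L,
        (∏ i, (-1 : ℝ) ^ (m i : ℕ) / s (eq.symm i) (m i)) * F (x + ∑ i, s (eq.symm i) (m i) ^ 2) := by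
    refine Fintype.sum_equiv (eq.arrowCongr (Equiv.refl (Fin L))) _ _ (fun m => ?_)
    have h1 : (∏ κ, (-1 : ℝ) ^ (m κ : ℕ) / s κ (m κ)) =
        ∏ i, (-1 : ℝ) ^ ((eq.arrowCongr (Equiv.refl (Fin L)) m) i : ℕ) /
          s (eq.symm i) ((eq.arrowCongr (Equiv.refl (Fin L)) m) i) :=
      Fintype.prod_equiv eq _ _ (fun κ => by simp [Equiv.arrowCongr_apply])
    have h2 : (∑ κ, s κ (m κ) ^ 2) = ∑ i, s (eq.symm i) ((eq.arrowCongr (Equiv.refl (Fin L)) m) i) ^ 2 :=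
      Fintype.sum_equiv eq _ _ (fun κ => by simp [Equiv.arrowCongr_apply])
    rw [h1, h2]
  have key2 : ∑ m : J → Fin L, (∏ κ, (s κ (m κ) ^ 2)⁻¹) * F (x + ∑ κ, s κ (m κ) ^ 2) =
      ∑ m : Fin n → Fin L,
        (∏ i, (s (eq.symm i) (m i) ^ 2)⁻¹) * F (x + ∑ i, s (eq.symm i) (m i) ^ 2) := by
    refine Fintype.sum_equiv (eq.arrowCongr (Equiv.refl (Fin L))) _ _ (fun m => ?_)
    have h1 : (∏ κ, (s κ (m κ) ^ 2)⁻¹) =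
        ∏ i, (s (eq.symm i) ((eq.arrowCongr (Equiv.refl (Fin L)) m) i) ^ 2)⁻¹ :=
      Fintype.prod_equiv eq _ _ (fun κ => by simp [Equiv.arrowCongr_apply])
    have h2 : (∑ κ, s κ (m κ) ^ 2) = ∑ i, s (eq.symm i) ((eq.arrowCongr (Equiv.refl (Fin L)) m) i) ^ 2 :=
      Fintype.sum_equiv eq _ _ (fun κ => by simp [Equiv.arrowCongr_apply])
    rw [h1, h2]
  have key3 : (∏ κ, w κ) = ∏ i, w (eq.symm i) :=
    Fintype.prod_equiv eq _ _ (fun κ => by simp)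
  rw [key1, key2, key3]
  exact aliasCore_margin_fin_of_order hL k₀ n (fun i => s (eq.symm i)) (fun i m hm => hs0 _ m hm) (fun i => hs _)
    (fun i => w (eq.symm i)) (fun i => hw0 _) (fun i => hw _) F hF x hx

end Summit.QuantumFields.YangMills.Theorems.N07AliasSumMarginSharp

end
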